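import Mathlib
import HarnessLib
import Literature.Analysis.FluidPDE.Tao2016AveragedNS.LocalCascadeSolutions
import Literature.Analysis.FluidPDE.Tao2016AveragedNS.RenormalisedCascadeWaves
import Summits.NavierStokesRegularity.NavierStokesRegularity.Theorems.WakeRatchetMinimalViscousBlowupEveryShellFires
import Summits.NavierStokesRegularity.NavierStokesRegularity.Theorems.WakeRatchetMinimalViscousBlowupEnergyBudget
import Summits.NavierStokesRegularity.NavierStokesRegularity.Theorems.TaoLadderRungTwoBreakEternalRigidityViscBddOneFiringFloor

/-!
# Crux `TaoLadderRungTwoBreak.EternalRigidityViscBddOne` (stmt-NavierStokesRegularity-20420): the DISSIPATION LEDGER of a viscous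
# blow-up — (i) the firing floor with its constant EXPOSED, `c₀ = 1/(32768(1+ε₀)^16)`, and (ii) the SUMMED dissipation budget
# `Σ_{k<K} ν λ^{2k} ∫_{(0,T']} ‖X_k‖² ≤ Σ_i ½X₀ᵢ²`

MODEL lattice ODEs only (Tao 2016 §4: the exact NS-scaled `ν`-viscous cascade lattice of a table of `InTableClass R`, `m = 4`, from a
one-shell datum); nothing here is a statement about the Navier–Stokes equations; no stub, crux or summit is closed
(`--supports stmt-NavierStokesRegularity-20420`).  `λ = 1+ε₀`.  Tools for `…EternalRigidityViscBddOneReynoldsThreshold` (the blow-up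
threshold in `Σ_i X₀ᵢ²/ν²` DIVERGES like `(λ²−1)^{-1/2}` as `ε₀ → 0` at fixed spread): that argument multiplies the firing floor on EVERY
shell by the rise time of the shell and SUMS the resulting dissipation over `≍ 1/ε₀` shells, so it needs

* `everyShellFires_explicit` — the tree's `EternalRigidityViscBddOne.FiringFloor.everyShellFires_of_blowup` with the firing constant NOT
  hidden behind an existential: every regular `ν`-trajectory from a one-shell datum that BLOWS UP at `T` (weight-10 norm unbounded on
  `[0,T)`) has, on every shell `n ≥ 0`, a time `t < T` with `ν²/(32768 λ^{16}) ≤ λⁿ‖X_n(t)‖²` (same proof: a never-firing shell is a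
  closed valve, `valve_induction` traps the shells above, `shellEnergy_le_datum` bounds the shells below, the weight-10 norm stays bounded);
* `dissipation_budget_sum_window` — the SUMMED form of the tree's `MinimalViscousBlowup.ThresholdRay.shell_dissipation_budget_window`:
  for every window `(0,T']`, `T' < T`, and every `K`, `∫_{(0,T']} ν Σ_{k<K} λ^{2k}‖X_k‖² ≤ Σ_i ½X₀ᵢ²` (truncated energy identity
  `E_L' = −Π_{L−1} − ν Σ_{j<L} λ^{2j}‖X_j‖²`, `hasDerivWithinAt_blockEnergy`; top flux `≤ 4³M³λ^{−L}` under the weight-10 bound,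
  `abs_botSum_le_of_weight10`; the partial sum `k < K ≤ L` of the dissipation is dominated by the full one; `L → ∞`), and its
  per-shell-integral form `dissipation_budget_finset_sum_window` (`Σ_{k<K} ν λ^{2k} ∫_{(0,T']}‖X_k‖² ≤ Σ_i ½X₀ᵢ²`).

HONEST LABEL: two bookkeeping variants of landed theorems (constant exposed / sum instead of one shell); (ω3) `stub_typeOne`,
(ω4) `stub_eternalLimitViscBdd`, ⟨20420⟩ and every NS statement remain OPEN; rung 0.
-/

noncomputable section

-- the summit and its single sub-problem share the name (CONVENTIONS §1)
set_option linter.dupNamespace false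

namespace Summit.NavierStokesRegularity.NavierStokesRegularity.Theorems.EternalRigidityViscBddOne.DissipationLedger

open Set Filter Topology MeasureTheory
open Literature.Analysis.FluidPDE Literature.Analysis.FluidPDE.TaoCascade
open Summit.NavierStokesRegularity.NavierStokesRegularity.Theorems.MinimalViscousBlowup.ThresholdRay
open Summit.NavierStokesRegularity.NavierStokesRegularity.Theorems.EternalRigidityViscBddOne.FiringFloor

/-! ## (i) Every shell fires — the constant exposed -/

/-- **EVERY SHELL FIRES, with the explicit constant `c₀ = 1/(32768(1+ε₀)^16)`.**  For a table of `InTableClass R`, every regular trajectory of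
the NS-scaled `ν`-viscous cascade lattice (`ν > 0`) on `[0,T)` from a one-shell datum (no shells below `0`) whose weight-10 norm is unbounded on
`[0,T)` excites every shell `n ≥ 0` to `λⁿ‖X_n(t)‖² ≥ ν²/(32768 λ^{16})` at some `t < T`.  (VERBATIM the proof of the tree's
`everyShellFires_of_blowup`, whose statement hides the same constant behind `∃ c₀`.)
[cite: Tao2016AveragedNS, §4 (4.3), Lemma 4.1 (4.5), proof of (4.13); BarbatoMorandinRomito2011, §3.1; tree `valve_induction`, `shellEnergy_le_datum`] -/
theorem everyShellFires_explicit {ε₀ R ν T : ℝ} (hε : 0 < ε₀) (hR : 1 ≤ R) (hν : 0 < ν) (hT : 0 < T)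
    {α : Fin 4 → Fin 4 → Fin 4 → ℤ × ℤ × ℤ → ℝ} (hα : InTableClass R α)
    {X₀ : Fin 4 → ℝ} {X : Fin 4 → ℤ → ℝ → ℝ}
    (hcd : ∀ i n, ContDiffOn ℝ 1 (X i n) (Ico 0 T))
    (hinit : ∀ i n, X i n 0 = if n = 0 then X₀ i else 0)
    (hlow : ∀ i n t, n < 0 → X i n t = 0)
    (hmot : ∀ i n t, 0 ≤ t → t < T → derivWithin (X i n) (Ici 0) t =
      quadTerm ε₀ α X i n t - ν * (1 + ε₀) ^ ((2 : ℝ) * n) * X i n t)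
    (hreg : ∀ T' : ℝ, 0 < T' → T' < T → ∃ M : ℝ, ∀ t : ℝ, 0 ≤ t → t ≤ T' →
      ∀ (i : Fin 4) (n : ℤ), (1 + (1 + ε₀) ^ ((10 : ℝ) * n)) * |X i n t| ≤ M)
    (hblow : ∀ M : ℝ, ∃ t : ℝ, 0 ≤ t ∧ t < T ∧ ∃ (i : Fin 4) (n : ℤ), M < (1 + (1 + ε₀) ^ ((10 : ℝ) * n)) * |X i n t|)
    (n : ℕ) :
    ∃ t : ℝ, 0 ≤ t ∧ t < T ∧
      1 / (32768 * (1 + ε₀) ^ 16) * ν ^ 2 ≤ (1 + ε₀) ^ n * ‖shellVec X n t‖ ^ 2 := by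
  -- adapted from `EternalRigidityViscBddOne.FiringFloor.everyShellFires_of_blowup`
  -- (Theorems/TaoLadderRungTwoBreakEternalRigidityViscBddOneFiringFloor.lean), constant exposed
  have _hR := hR
  have hl0 : (0 : ℝ) < 1 + ε₀ := by linarith
  have hl1 : (1 : ℝ) ≤ 1 + ε₀ := by linarith
  set c₀ : ℝ := 1 / (32768 * (1 + ε₀) ^ 16) with hc₀
  have hc₀0 : 0 < c₀ := by rw [hc₀]; positivity
  by_contra hfire
  -- shell `n` is a closed valve
  have hvalve : ∀ t, 0 ≤ t → t < T → (1 + ε₀) ^ n * ‖shellVec X n t‖ ^ 2 ≤ c₀ * ν ^ 2 := by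
    intro t h0 htT
    by_contra h
    exact hfire ⟨t, h0, htT, (not_le.1 h).le⟩
  have hcan : IsCancellingCoeff α := hα.2.1
  have hα1 : ∀ i₁ i₂ i₃ : Fin 4, |α i₁ i₂ i₃ (0, 0, 1)| ≤ 1 := fun i₁ i₂ i₃ =>
    abs_le_one_of_inTableClass hα i₁ i₂ i₃ _ (by rw [mem_shiftSet_iff]; simp)
  have hP := valve_induction hε hν hT hc₀0 le_rfl hcan hα1 hcd hinit hmot hreg n hvalve
  -- the energy bound below the valve
  set E : ℝ := ∑ i : Fin 4, X₀ i ^ 2 with hEdef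
  have hE0 : 0 ≤ E := Finset.sum_nonneg fun i _ => sq_nonneg _
  have hE := shellEnergy_le_datum hε hν.le hcan hα1 hcd hinit hlow hmot hreg
  -- the weight-20 bound above `n`
  have hup : ∀ (j : ℕ) (t : ℝ), 0 ≤ t → t < T →
      ((1 + ε₀) ^ (10 * (n + j)) * ‖shellVec X ((n + j : ℕ) : ℤ) t‖) ^ 2 ≤ (1 + ε₀) ^ (19 * n) * c₀ * ν ^ 2 := by
    intro j t h0 htT
    have h1 := hP j t h0 htT
    have hcj : (1 + ε₀) ^ (19 * j) * (c₀ / (2 * (1 + ε₀) ^ 19) ^ j) ≤ c₀ := by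
      rw [mul_pow, ← pow_mul, show 19 * j = j * 19 by ring]
      have h2 : (1 + ε₀) ^ (j * 19) * (c₀ / (2 ^ j * (1 + ε₀) ^ (j * 19))) = c₀ / 2 ^ j := by
        field_simp
      rw [h2]
      exact div_le_self hc₀0.le (one_le_pow₀ (by norm_num))
    have hv := sq_nonneg ‖shellVec X ((n + j : ℕ) : ℤ) t‖
    calc ((1 + ε₀) ^ (10 * (n + j)) * ‖shellVec X ((n + j : ℕ) : ℤ) t‖) ^ 2
        = (1 + ε₀) ^ (19 * n) * ((1 + ε₀) ^ (19 * j) *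
            ((1 + ε₀) ^ (n + j) * ‖shellVec X ((n + j : ℕ) : ℤ) t‖ ^ 2)) := by ring
      _ ≤ (1 + ε₀) ^ (19 * n) * ((1 + ε₀) ^ (19 * j) * (c₀ / (2 * (1 + ε₀) ^ 19) ^ j * ν ^ 2)) := by
          gcongr
      _ = (1 + ε₀) ^ (19 * n) * ((1 + ε₀) ^ (19 * j) * (c₀ / (2 * (1 + ε₀) ^ 19) ^ j)) * ν ^ 2 := by ring
      _ ≤ (1 + ε₀) ^ (19 * n) * c₀ * ν ^ 2 := by
          have := mul_le_mul_of_nonneg_left hcj (pow_nonneg hl0.le (19 * n))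
          nlinarith [sq_nonneg ν]
  -- a uniform weight-10 bound, contradicting the blow-up
  set B₁ : ℝ := Real.sqrt ((1 + ε₀) ^ (19 * n) * c₀) * ν with hB₁
  have hB₁0 : 0 ≤ B₁ := by rw [hB₁]; positivity
  set B : ℝ := 2 * (1 + ε₀) ^ (10 * n) * Real.sqrt E + 2 * B₁ + 1 with hB
  obtain ⟨t, ht0, htT, i, k, hk⟩ := hblow B
  have hbound : (1 + (1 + ε₀) ^ ((10 : ℝ) * k)) * |X i k t| ≤ 2 * (1 + ε₀) ^ (10 * n) * Real.sqrt E + 2 * B₁ := by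
    rcases lt_or_ge k 0 with hkneg | hk0
    · rw [hlow i k t hkneg, abs_zero, mul_zero]; positivity
    · obtain ⟨k', rfl⟩ := Int.eq_ofNat_of_zero_le hk0
      have hw : (1 + ε₀) ^ ((10 : ℝ) * ((k' : ℕ) : ℤ)) = (1 + ε₀) ^ (10 * k') := by
        rw [show ((10 : ℝ) * (((k' : ℕ) : ℤ) : ℝ)) = ((10 * k' : ℕ) : ℝ) by push_cast; ring, Real.rpow_natCast]
      rw [hw]
      have habs := abs_apply_le_norm_shellVec X k' t i
      have hw1 : (1 : ℝ) ≤ (1 + ε₀) ^ (10 * k') := one_le_pow₀ hl1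
      rcases lt_or_ge k' n with hlt | hge
      · -- below the valve: the energy bound
        have hn2 : ‖shellVec X (k' : ℤ) t‖ ^ 2 ≤ E := hE k' t ht0 htT
        have hnC : ‖shellVec X (k' : ℤ) t‖ ≤ Real.sqrt E := (Real.le_sqrt (norm_nonneg _) hE0).2 hn2
        have hwk : (1 + ε₀) ^ (10 * k') ≤ (1 + ε₀) ^ (10 * n) := pow_le_pow_right₀ hl1 (by omega)
        have hsC : 0 ≤ Real.sqrt E := Real.sqrt_nonneg E
        calc (1 + (1 + ε₀) ^ (10 * k')) * |X i (k' : ℤ) t|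
            ≤ (2 * (1 + ε₀) ^ (10 * n)) * Real.sqrt E :=
              mul_le_mul (by linarith) (habs.trans hnC) (abs_nonneg _) (by positivity)
          _ = 2 * (1 + ε₀) ^ (10 * n) * Real.sqrt E := by ring
          _ ≤ 2 * (1 + ε₀) ^ (10 * n) * Real.sqrt E + 2 * B₁ := by linarith
      · -- above the valve: the trapped shells
        obtain ⟨j, rfl⟩ := Nat.exists_eq_add_of_le hge
        have hsq := hup j t ht0 htT
        have hB₁sq : B₁ ^ 2 = (1 + ε₀) ^ (19 * n) * c₀ * ν ^ 2 := by
          rw [hB₁, mul_pow, Real.sq_sqrt (by positivity)]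
        have hle : (1 + ε₀) ^ (10 * (n + j)) * ‖shellVec X ((n + j : ℕ) : ℤ) t‖ ≤ B₁ :=
          (pow_le_pow_iff_left₀ (by positivity) hB₁0 two_ne_zero).1 (by rw [hB₁sq]; exact hsq)
        calc (1 + (1 + ε₀) ^ (10 * (n + j))) * |X i ((n + j : ℕ) : ℤ) t|
            ≤ (2 * (1 + ε₀) ^ (10 * (n + j))) * ‖shellVec X ((n + j : ℕ) : ℤ) t‖ :=
              mul_le_mul (by linarith) habs (abs_nonneg _) (by positivity)
          _ = 2 * ((1 + ε₀) ^ (10 * (n + j)) * ‖shellVec X ((n + j : ℕ) : ℤ) t‖) := by ring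
          _ ≤ 2 * B₁ := by linarith
          _ ≤ 2 * (1 + ε₀) ^ (10 * n) * Real.sqrt E + 2 * B₁ := by
              have : 0 ≤ 2 * (1 + ε₀) ^ (10 * n) * Real.sqrt E := by positivity
              linarith
  have : B ≤ 2 * (1 + ε₀) ^ (10 * n) * Real.sqrt E + 2 * B₁ := hk.le.trans hbound
  rw [hB] at this
  linarith

/-! ## (ii) The summed dissipation budget on a window -/

/-- **Summed dissipation budget on a window (integral of the sum).**  For a regular trajectory of the `ν`-viscous lattice on `[0,T)` from the
one-shell datum `X₀` (cancelling table, `|α_{··(0,0,1)}| ≤ 1`, no shells below `0`), every `T' ∈ (0,T)` and every `K`: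
`∫_{(0,T']} ν·Σ_{k<K} λ^{2k}‖X_k(t)‖² dt ≤ Σ_i ½X₀ᵢ²` — the energy dissipated by the shells `0, …, K−1` together never exceeds the
datum energy. [cite: Tao2016AveragedNS, §4 proof of (4.13) (energy identity under (4.3)), Lemma 4.1 (4.5), (4.11)] -/
theorem dissipation_budget_sum_window {ε₀ ν T T' : ℝ} (hε : 0 < ε₀) (hν : 0 < ν)
    {α : Fin 4 → Fin 4 → Fin 4 → ℤ × ℤ × ℤ → ℝ} (hcan : IsCancellingCoeff α)
    (hα1 : ∀ i₁ i₂ i₃, |α i₁ i₂ i₃ (0, 0, 1)| ≤ 1) {X : Fin 4 → ℤ → ℝ → ℝ} {X₀ : Fin 4 → ℝ}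
    (hcd : ∀ i n, ContDiffOn ℝ 1 (X i n) (Ico 0 T))
    (hinit : ∀ i n, X i n 0 = if n = 0 then X₀ i else 0)
    (hlow : ∀ i n t, n < 0 → 0 ≤ t → X i n t = 0)
    (hmot : ∀ i n t, 0 ≤ t → t < T → derivWithin (X i n) (Ici 0) t =
      quadTerm ε₀ α X i n t - ν * (1 + ε₀) ^ ((2 : ℝ) * n) * X i n t)
    (hreg : ∀ T' : ℝ, 0 < T' → T' < T → ∃ M : ℝ, ∀ t : ℝ, 0 ≤ t → t ≤ T' →
      ∀ (i : Fin 4) (n : ℤ), (1 + (1 + ε₀) ^ ((10 : ℝ) * n)) * |X i n t| ≤ M)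
    (hT'0 : 0 < T') (hT'T : T' < T) (K : ℕ) :
    ∫ t in Ioc 0 T', ν * ∑ k ∈ Finset.range K, (1 + ε₀) ^ (2 * k) * ‖shellVec X k t‖ ^ 2 ≤
      ∑ i : Fin 4, (1 / 2 : ℝ) * X₀ i ^ 2 := by
  -- adapted from `MinimalViscousBlowup.ThresholdRay.shell_dissipation_budget_window`
  -- (Theorems/WakeRatchetMinimalViscousBlowupShellDissipationBudget.lean): one shell replaced by the partial sum `k < K`
  have hl0 : (0 : ℝ) < 1 + ε₀ := by linarith
  have hl1 : (1 : ℝ) < 1 + ε₀ := by linarith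
  set E₀ : ℝ := ∑ i : Fin 4, (1 / 2 : ℝ) * X₀ i ^ 2 with hE₀
  have hE₀0 : 0 ≤ E₀ := Finset.sum_nonneg fun i _ => by positivity
  -- the larger window `[0,T'']`
  set T'' : ℝ := (T' + T) / 2 with hT''
  have hT'T'' : T' < T'' := by rw [hT'']; linarith
  have hT''T : T'' < T := by rw [hT'']; linarith
  have hderW := hasDerivWithinAt_window_of_clauses (ε₀ := ε₀) (ν := ν) (α := α) hcd hmot hT''T
  obtain ⟨M₀, hM₀⟩ := hreg T'' (hT'0.trans hT'T'') hT''T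
  set M : ℝ := max M₀ 0 with hMdef
  have hM0 : 0 ≤ M := le_max_right _ _
  have hM : ∀ t : ℝ, 0 ≤ t → t ≤ T'' → ∀ (i : Fin 4) (n : ℤ), (1 + (1 + ε₀) ^ ((10 : ℝ) * n)) * |X i n t| ≤ M :=
    fun t ht htT i n => (hM₀ t ht htT i n).trans (le_max_left _ _)
  set r : ℝ := (1 + ε₀)⁻¹ with hr
  have hr0 : 0 < r := by rw [hr]; exact inv_pos.2 hl0
  have hr1 : r < 1 := by rw [hr]; exact inv_lt_one_of_one_lt₀ hl1
  -- the partial dissipation density and its integrability on the window (continuity)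
  set dK : ℝ → ℝ := fun t => ν * ∑ k ∈ Finset.range K, (1 + ε₀) ^ (2 * k) * ‖shellVec X k t‖ ^ 2 with hdK
  have hXc : ∀ (k : ℕ) (i : Fin 4), ContinuousOn (fun t => X i k t) (Icc 0 T') := fun k i =>
    ((hcd i k).continuousOn).mono fun t ht => ⟨ht.1, lt_of_le_of_lt ht.2 hT'T⟩
  have hdKc : ContinuousOn dK (Icc 0 T') := by
    have h1 : ∀ k : ℕ, ContinuousOn (fun t => ∑ i : Fin 4, X i k t ^ 2) (Icc 0 T') := fun k =>
      continuousOn_finsetSum _ fun i _ => (hXc k i).pow 2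
    have h2 : dK = fun t => ν * ∑ k ∈ Finset.range K, (1 + ε₀) ^ (2 * k) * ∑ i : Fin 4, X i k t ^ 2 := by
      funext t; rw [hdK]; dsimp only
      congr 1
      exact Finset.sum_congr rfl fun k _ => by rw [norm_shellVec_sq]
    rw [h2]
    exact continuousOn_const.mul (continuousOn_finsetSum _ fun k _ => continuousOn_const.mul (h1 k))
  have hdKint : IntegrableOn dK (Ioc 0 T') :=
    (hdKc.integrableOn_Icc).mono_set Ioc_subset_Icc_self
  -- MAIN STEP: for every `L ≥ K`, `L ≥ 1`, `∫_{(0,T']} dK ≤ E₀ + 4³M³ r^L T'`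
  have hstep : ∀ L : ℕ, K ≤ L → 1 ≤ L → ∫ t in Ioc 0 T', dK t ≤ E₀ + (4 : ℝ) ^ 3 * M ^ 3 * r ^ L * T' := by
    intro L hKL hL1
    set cL : ℝ := (4 : ℝ) ^ 3 * M ^ 3 * r ^ L with hcL
    have hcL0 : 0 ≤ cL := by rw [hcL]; positivity
    set EL : ℝ → ℝ := fun w => ∑ j ∈ Finset.Ico 0 L, ∑ i : Fin 4, (1 / 2 : ℝ) * X i j w ^ 2 with hEL
    set DL : ℝ → ℝ := fun u => ν * ∑ j ∈ Finset.Ico 0 L, (1 + ε₀) ^ ((2 : ℝ) * (j : ℤ)) * ∑ i : Fin 4, X i j u ^ 2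
      with hDL
    set BL : ℝ → ℝ := fun u => botSum ε₀ α X ((L : ℤ) - 1) u with hBL
    have hELder : ∀ u ∈ Icc (0 : ℝ) T'', HasDerivWithinAt EL (-BL u - DL u) (Icc 0 T'') u := by
      intro u hu
      have h := hasDerivWithinAt_blockEnergy (ε₀ := ε₀) (ν := ν) hcan (fun i j => hderW i j u hu) (Nat.zero_le L)
      have h0 : botSum ε₀ α X (((0 : ℕ) : ℤ) - 1) u = 0 := by
        rw [Nat.cast_zero, zero_sub]; exact botSum_neg_one_eq_zero hlow hu.1
      rw [h0, zero_sub] at h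
      exact h
    have hBLle : ∀ u ∈ Icc (0 : ℝ) T'', |BL u| ≤ cL := by
      intro u hu
      obtain ⟨L', hL'⟩ := Nat.exists_eq_add_of_le hL1
      have h := abs_botSum_le_of_weight10 (m := 4) hε hM0 hα1 (fun i n => hM u hu.1 hu.2 i n) L'
      have e1 : ((L : ℤ) - 1) = (L' : ℤ) := by rw [hL']; push_cast; ring
      have e2 : L' + 1 = L := by omega
      rw [hBL]; dsimp only; rw [e1]
      calc |botSum ε₀ α X (L' : ℤ) u| ≤ (4 : ℝ) ^ 3 * M ^ 3 * ((1 + ε₀)⁻¹) ^ (L' + 1) := by exact_mod_cast h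
        _ = cL := by rw [hcL, hr, e2]
    -- `dK ≤ DL` pointwise (a partial sum of a sum of nonnegative terms)
    have hdKDL : ∀ u, dK u ≤ DL u := by
      intro u
      have hterm : ∀ k : ℕ, (1 + ε₀) ^ ((2 : ℝ) * ((k : ℕ) : ℤ)) * ∑ i : Fin 4, X i k u ^ 2
          = (1 + ε₀) ^ (2 * k) * ‖shellVec X k u‖ ^ 2 := by
        intro k
        rw [norm_shellVec_sq,
          show (2 : ℝ) * (((k : ℕ) : ℤ) : ℝ) = ((2 * k : ℕ) : ℝ) by push_cast; ring, Real.rpow_natCast]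
      have hsub : Finset.range K ⊆ Finset.Ico 0 L := by
        intro k hk
        rw [Finset.mem_range] at hk
        exact Finset.mem_Ico.mpr ⟨Nat.zero_le _, lt_of_lt_of_le hk hKL⟩
      have hpart : ∑ k ∈ Finset.range K, (1 + ε₀) ^ ((2 : ℝ) * ((k : ℕ) : ℤ)) * ∑ i : Fin 4, X i k u ^ 2
          ≤ ∑ j ∈ Finset.Ico 0 L, (1 + ε₀) ^ ((2 : ℝ) * (j : ℤ)) * ∑ i : Fin 4, X i j u ^ 2 :=
        Finset.sum_le_sum_of_subset_of_nonneg hsub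
          (fun j _ _ => mul_nonneg (Real.rpow_nonneg hl0.le _) (Finset.sum_nonneg fun i _ => sq_nonneg _))
      have heq : ∑ k ∈ Finset.range K, (1 + ε₀) ^ (2 * k) * ‖shellVec X k u‖ ^ 2
          = ∑ k ∈ Finset.range K, (1 + ε₀) ^ ((2 : ℝ) * ((k : ℕ) : ℤ)) * ∑ i : Fin 4, X i k u ^ 2 :=
        Finset.sum_congr rfl fun k _ => (hterm k).symm
      rw [hdK, hDL]; dsimp only
      rw [heq]
      exact mul_le_mul_of_nonneg_left hpart hν.le
    have hdK0 : ∀ u, 0 ≤ dK u := fun u => by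
      rw [hdK]; dsimp only
      exact mul_nonneg hν.le (Finset.sum_nonneg fun k _ => by positivity)
    have hDL0 : ∀ u, 0 ≤ DL u := fun u => (hdK0 u).trans (hdKDL u)
    -- the monotone potential
    set g : ℝ → ℝ := fun w => E₀ + cL * w - EL w with hg
    set g' : ℝ → ℝ := fun u => cL + BL u + DL u with hg'
    have hgder : ∀ u ∈ Icc (0 : ℝ) T'', HasDerivWithinAt g (g' u) (Icc 0 T'') u := by
      intro u hu
      have h1 : HasDerivWithinAt (fun w => E₀ + cL * w) cL (Icc 0 T'') u := by
        have := ((hasDerivAt_id u).const_mul cL).const_add E₀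
        simpa using this.hasDerivWithinAt
      refine (h1.sub (hELder u hu)).congr_deriv ?_
      rw [hg']; ring
    have hg'0 : ∀ u ∈ Icc (0 : ℝ) T'', 0 ≤ g' u := by
      intro u hu
      have h1 := hBLle u hu
      have h2 := hDL0 u
      rw [hg']; dsimp only
      linarith [neg_abs_le (BL u)]
    have hcont : ContinuousOn g (Icc 0 T') := by
      intro u hu
      have hu' : u ∈ Icc (0 : ℝ) T'' := ⟨hu.1, hu.2.trans hT'T''.le⟩
      exact ((hgder u hu').continuousWithinAt).mono (Icc_subset_Icc_right hT'T''.le)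
    have hderiv : ∀ u ∈ Ioo (0 : ℝ) T', HasDerivAt g (g' u) u := by
      intro u hu
      have hu' : u ∈ Icc (0 : ℝ) T'' := ⟨hu.1.le, (hu.2.trans hT'T'').le⟩
      exact (hgder u hu').hasDerivAt (Icc_mem_nhds hu.1 (hu.2.trans hT'T''))
    have hpos : ∀ u ∈ Ioo (0 : ℝ) T', 0 ≤ g' u := fun u hu => hg'0 u ⟨hu.1.le, (hu.2.trans hT'T'').le⟩
    have hint : IntegrableOn g' (Ioc 0 T') := intervalIntegral.integrableOn_deriv_of_nonneg hcont hderiv hpos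
    have hFTC : ∫ u in Ioc 0 T', g' u = g T' - g 0 := by
      rw [← intervalIntegral.integral_of_le hT'0.le]
      exact intervalIntegral.integral_eq_sub_of_hasDerivAt_of_le hT'0.le hcont hderiv
        ((intervalIntegrable_iff_integrableOn_Ioc_of_le hT'0.le).mpr hint)
    have hEL0 : EL 0 = E₀ := by
      rw [hEL, hE₀]; dsimp only
      rw [Finset.sum_eq_single_of_mem 0 (Finset.mem_Ico.mpr ⟨le_rfl, by omega⟩)]
      · simp [hinit]
      · intro j _ hj0
        simp [hinit, hj0]
    have hELT' : 0 ≤ EL T' := by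
      rw [hEL]; dsimp only
      exact Finset.sum_nonneg fun j _ => Finset.sum_nonneg fun i _ => by positivity
    have hIle : ∫ u in Ioc 0 T', g' u ≤ E₀ + cL * T' := by
      rw [hFTC, hg]; dsimp only; rw [hEL0]; linarith
    -- `∫ dK ≤ ∫ g'`
    have hmono : ∫ u in Ioc 0 T', dK u ≤ ∫ u in Ioc 0 T', g' u := by
      refine setIntegral_mono_on hdKint hint measurableSet_Ioc fun u hu => ?_
      have h1 := hdKDL u
      have h2 := hBLle u ⟨hu.1.le, hu.2.trans hT'T''.le⟩
      show dK u ≤ cL + BL u + DL u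
      linarith [neg_abs_le (BL u)]
    calc ∫ u in Ioc 0 T', dK u ≤ E₀ + cL * T' := hmono.trans hIle
      _ = E₀ + (4 : ℝ) ^ 3 * M ^ 3 * r ^ L * T' := by rw [hcL]
  -- `L → ∞`
  have hle : ∫ t in Ioc 0 T', dK t ≤ E₀ := by
    refine le_of_forall_pos_le_add fun η hη => ?_
    obtain ⟨n, hn⟩ := exists_pow_lt_of_lt_one (show 0 < η / ((4 : ℝ) ^ 3 * M ^ 3 * T' + 1) by positivity) hr1
    set L : ℕ := max n (K + 1) with hLdef
    have hKL : K ≤ L := by omega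
    have hL1 : 1 ≤ L := by omega
    have hrL : r ^ L ≤ r ^ n := pow_le_pow_of_le_one hr0.le hr1.le (le_max_left _ _)
    have h := hstep L hKL hL1
    have hA : 0 ≤ (4 : ℝ) ^ 3 * M ^ 3 * T' := by positivity
    have h1 : (4 : ℝ) ^ 3 * M ^ 3 * r ^ L * T' ≤ ((4 : ℝ) ^ 3 * M ^ 3 * T') * r ^ n := by
      calc (4 : ℝ) ^ 3 * M ^ 3 * r ^ L * T' = ((4 : ℝ) ^ 3 * M ^ 3 * T') * r ^ L := by ring
        _ ≤ ((4 : ℝ) ^ 3 * M ^ 3 * T') * r ^ n := mul_le_mul_of_nonneg_left hrL hA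
    have h2 : ((4 : ℝ) ^ 3 * M ^ 3 * T') * r ^ n ≤
        ((4 : ℝ) ^ 3 * M ^ 3 * T' + 1) * (η / ((4 : ℝ) ^ 3 * M ^ 3 * T' + 1)) :=
      mul_le_mul (by linarith) hn.le (pow_nonneg hr0.le _) (by positivity)
    have h3 : ((4 : ℝ) ^ 3 * M ^ 3 * T' + 1) * (η / ((4 : ℝ) ^ 3 * M ^ 3 * T' + 1)) = η := by field_simp
    linarith
  rw [hdK] at hle
  exact hle

/-- **Summed dissipation budget on a window (sum of the shell integrals).**  Same setting: for every `T' ∈ (0,T)` and every `K`,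
`Σ_{k<K} ν·λ^{2k}·∫_{(0,T']} ‖X_k(t)‖² dt ≤ Σ_i ½X₀ᵢ²`. [cite: Tao2016AveragedNS, §4 proof of (4.13), Lemma 4.1 (4.5), (4.11)] -/
theorem dissipation_budget_finset_sum_window {ε₀ ν T T' : ℝ} (hε : 0 < ε₀) (hν : 0 < ν)
    {α : Fin 4 → Fin 4 → Fin 4 → ℤ × ℤ × ℤ → ℝ} (hcan : IsCancellingCoeff α)
    (hα1 : ∀ i₁ i₂ i₃, |α i₁ i₂ i₃ (0, 0, 1)| ≤ 1) {X : Fin 4 → ℤ → ℝ → ℝ} {X₀ : Fin 4 → ℝ}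
    (hcd : ∀ i n, ContDiffOn ℝ 1 (X i n) (Ico 0 T))
    (hinit : ∀ i n, X i n 0 = if n = 0 then X₀ i else 0)
    (hlow : ∀ i n t, n < 0 → 0 ≤ t → X i n t = 0)
    (hmot : ∀ i n t, 0 ≤ t → t < T → derivWithin (X i n) (Ici 0) t =
      quadTerm ε₀ α X i n t - ν * (1 + ε₀) ^ ((2 : ℝ) * n) * X i n t)
    (hreg : ∀ T' : ℝ, 0 < T' → T' < T → ∃ M : ℝ, ∀ t : ℝ, 0 ≤ t → t ≤ T' →
      ∀ (i : Fin 4) (n : ℤ), (1 + (1 + ε₀) ^ ((10 : ℝ) * n)) * |X i n t| ≤ M)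
    (hT'0 : 0 < T') (hT'T : T' < T) (K : ℕ) :
    ∑ k ∈ Finset.range K, ν * (1 + ε₀) ^ (2 * k) * ∫ t in Ioc 0 T', ‖shellVec X k t‖ ^ 2 ≤
      ∑ i : Fin 4, (1 / 2 : ℝ) * X₀ i ^ 2 := by
  have h := dissipation_budget_sum_window hε hν hcan hα1 hcd hinit hlow hmot hreg hT'0 hT'T K
  -- each shell density is continuous on `[0,T']`, hence integrable on the window
  have hXc : ∀ (k : ℕ) (i : Fin 4), ContinuousOn (fun t => X i k t) (Icc 0 T') := fun k i =>
    ((hcd i k).continuousOn).mono fun t ht => ⟨ht.1, lt_of_le_of_lt ht.2 hT'T⟩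
  have hfk : ∀ k : ℕ, IntegrableOn (fun t => (1 + ε₀) ^ (2 * k) * ‖shellVec X k t‖ ^ 2) (Ioc 0 T') := by
    intro k
    have h1 : ContinuousOn (fun t => ∑ i : Fin 4, X i k t ^ 2) (Icc 0 T') :=
      continuousOn_finsetSum _ fun i _ => (hXc k i).pow 2
    have h2 : (fun t => (1 + ε₀) ^ (2 * k) * ‖shellVec X k t‖ ^ 2)
        = fun t => (1 + ε₀) ^ (2 * k) * ∑ i : Fin 4, X i k t ^ 2 := by
      funext t; rw [norm_shellVec_sq]
    rw [h2]
    exact ((continuousOn_const.mul h1).integrableOn_Icc).mono_set Ioc_subset_Icc_self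
  have hswap : ∫ t in Ioc 0 T', ν * ∑ k ∈ Finset.range K, (1 + ε₀) ^ (2 * k) * ‖shellVec X k t‖ ^ 2
      = ∑ k ∈ Finset.range K, ν * (1 + ε₀) ^ (2 * k) * ∫ t in Ioc 0 T', ‖shellVec X k t‖ ^ 2 := by
    rw [integral_const_mul, integral_finsetSum _ fun k _ => hfk k, Finset.mul_sum]
    refine Finset.sum_congr rfl fun k _ => ?_
    rw [integral_const_mul]; ring
  rw [hswap] at h
  exact h

end Summit.NavierStokesRegularity.NavierStokesRegularity.Theorems.EternalRigidityViscBddOne.DissipationLedger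

end
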